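import Summits.BirchSwinnertonDyer.Rank1Residual.P2.PrintCf2VLineRestrictionStub
import Summits.BirchSwinnertonDyer.BirchSwinnertonDyer.Theorems.PrintCf2RubinValueTwoKatzMeasureJZeroTransport
import HarnessLib

/-!
# M-LINE-PIN stub (A) `stub_vLineRestriction` — `j = 0` TWIN: the analytic restriction to the `v`-line for `IsKatzMeasure₂₀` frames

Cell `bsd-print-cf2`, width seat `bsd-line-cf2-p1-w7` g14; crux `PrintCf2.SplitBadTwoRankOneOfFacts` (stmt-20368) / print leaf 24720 under
director OPTION 1 (the `j = 0` twin); the re-thread of 23300's closing chain for the planner's twin `MainConjClauseAtSplitTwoQuadDAClassJZero`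
(23300′).  `--supports stmt-BirchSwinnertonDyer-24720` (helper, Theses-free).  THEOREMS ONLY (no `def`, no named fact, no `sorry`); nothing is
closed; BSD is not proved by any of this; no summit statement is proved by this seat.

WHY THIS IS THE ONE NON-VERBATIM STEP OF THE RE-THREAD.  ty2 g36's engine `VLineRestriction.vLineRestriction_of_supply` reads the two-variable frame
only once: `π_v G₂` is a `ν`-branch of modulus `S ∪ {v̄}` (all types `(−m, 0)`, `m ≥ 1`), evaluated at cf2c-w3 g6's supply `θ_K⁻¹ρ_t` of weights
`m₀ + N t`, `m₀ ∈ {1, 2}`.  A `j = 0` frame (`IsKatzMeasure₂₀`) only knows `m ≥ 3`; but the identity principle needs the nodes `w·uᵗ − 1` for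
infinitely many `t` only, so the engine is re-run on the supply SHIFTED by two nodes (`t ↦ t + 2`, `w ↦ w·u²`, `m₀ ↦ m₀ + 2N ≥ 3`), with the
values of `π_v G₂` read directly from the frame (`KatzMeasureJZeroTransport.hasValueAt_map_constantCoeff₀`).

* `vLineRestriction_of_supply₀` — the engine for `IsKatzMeasure₂₀` frames and supplies with `m₀ ≥ 3` (proof VERBATIM otherwise);
* ★★ `stub_vLineRestriction₀` — stub (A)'s statement with `IsKatzMeasure₂₀`, closed by the shifted supply.

References: [deShalit1987] II Thm. 4.12, II.4.16 (49)–(50), II.4.17; [Muller2020SplitPrimeTwo] Thm. 2.4, Def. 2.5; [SerreAbelianLadic1968]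
Ch. III §2.3; [Washington1997] §7.1, §13.1.
-/

noncomputable section

set_option linter.dupNamespace false
set_option autoImplicit false

open scoped Classical NumberField Topology
open NumberField IsDedekindDomain Field Filter
open Literature Literature.NumberTheory.GaloisRepresentations Literature.NumberTheory.EllipticCurves
open Literature.NumberTheory.EllipticCurves.KellerYin2024 Literature.NumberTheory.EllipticCurves.GreenbergVatsal2000
open Literature.NumberTheory.EllipticCurves.DeShalit1987 Literature.NumberTheory.EllipticCurves.Muller2020
open Summit.BirchSwinnertonDyer.BirchSwinnertonDyer.Theorems Summit.BirchSwinnertonDyer.BirchSwinnertonDyer.Theorems.PrintCf2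
open Summit.BirchSwinnertonDyer.BirchSwinnertonDyer.Theorems.PrintCf2.FiniteTwist
open Summit.BirchSwinnertonDyer.Rank1Residual.P2.VLineRestriction

namespace Summit.BirchSwinnertonDyer.BirchSwinnertonDyer.Theorems.PrintCf2.VLineRestrictionJZero

variable {K : Type} [Field K] [NumberField K]

/-- ★ **THE `v`-LINE RESTRICTION FOR `j = 0` FRAMES** — `vLineRestriction_of_supply` (ty2 g36) VERBATIM except that the two-variable input is
an `IsKatzMeasure₂₀` frame (types `(−m,0)`, `m ≥ 3`) and, accordingly, the supply starts at `m₀ ≥ 3`: the values of `π_v G₂` at the supply points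
are read directly from the frame (`KatzMeasureJZeroTransport.hasValueAt_map_constantCoeff₀`); Müller's side, the Euler factor at `v̄`, the identity
principle (`span_eq_span_of_interpolationValue₀_values`) and case (iv) are untouched.
[cite: deShalit1987, II Thm. 4.12 (i)–(ii) (31)–(32), II.4.16 (49)–(50), II.4.17 (52)–(54)] [cite: Muller2020SplitPrimeTwo, Thm. 2.4, Def. 2.5]
[cite: SerreAbelianLadic1968, Ch. III §2.3] [cite: Washington1997, §7.1, §13.1] -/
theorem vLineRestriction_of_supply₀ (hK : IsImaginaryQuadratic K) (ι : PadicAlgCl 2 ≃+* ℂ)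
    {v vbar : HeightOneSpectrum (𝓞 K)} (hv : ((2 : ℕ) : 𝓞 K) ∈ v.asIdeal) (hvbar : ((2 : ℕ) : 𝓞 K) ∈ vbar.asIdeal) (hne : vbar ≠ v)
    (hι : ∀ (w : InfinitePlace K) (k : 𝓞 K), k ∈ v.asIdeal ↔ ‖ι.symm (w.embedding (k : K))‖ < 1)
    {Ω δ : ℂ} {Ωp : (unrIntegers 2)ˣ} (hΩ : Ω ≠ 0)
    {κ₁ κ₂ : ZpExtension K 2} {γ₁ γ₂ : absoluteGaloisGroup K} (hpair : ZpExtension.IsTopGeneratorPair κ₁ κ₂ γ₁ γ₂)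
    (hκ₁ : κ₁.IsUnramifiedOutside v)
    {θ : FramedGaloisRep K (padicCoeffIntegers (∅ : Set (PadicAlgCl 2))) 1} (hθ2 : ∀ σ : absoluteGaloisGroup K, θ σ ^ 2 = 1)
    {θK : HeckeCharacter K} (hH : IsHeckeCharOf ι θ θK)
    {S : Finset (HeightOneSpectrum (𝓞 K))} (hvS : v ∉ S) (hvbS : vbar ∉ S) (hSram : ∀ w ∈ S, ¬ θK.IsUnramifiedAt w)
    (hSunr : ∀ w : HeightOneSpectrum (𝓞 K), w ∉ S → w ≠ v → w ≠ vbar → θK.IsUnramifiedAt w)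
    {G₂ : PowerSeries (PowerSeries (PadicComplexInt 2))}
    (hG₂ : IsKatzMeasure₂₀ ι v vbar S κ₁ κ₂ γ₁⁻¹ γ₂⁻¹ θK⁻¹ Ω δ ((Ωp : unrIntegers 2) : ℂ_[2]) G₂)
    {S' : Finset (HeightOneSpectrum (𝓞 K))} (hvS' : v ∉ S') (hS'ram : ∀ w ∈ S', ¬ θK.IsUnramifiedAt w)
    (hS'unr : ∀ w : HeightOneSpectrum (𝓞 K), w ∉ S' → w ≠ v → θK.IsUnramifiedAt w)
    {Ω' : ℂ} {Ωp' : (unrIntegers 2)ˣ} {G₁ : PowerSeries (PadicComplexInt 2)} (hΩ' : Ω' ≠ 0)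
    (hG₁ : IsNuBranch ι v S' κ₁ γ₁⁻¹ θK⁻¹ Ω' ((Ωp' : unrIntegers 2) : ℂ_[2]) G₁) (hG₁0 : G₁ ≠ 0)
    (hsupply : ∃ (ρ : ℕ → HeckeCharacter K) (r : ℕ → FramedGaloisRep K (PadicAlgCl 2) 1) (w u : ℂ_[2]) (m₀ N : ℕ),
      3 ≤ m₀ ∧ 0 < N ∧ ‖w - 1‖ < 1 ∧ ‖u - 1‖ < ‖(2 : ℂ_[2])‖ ∧ u ≠ 1 ∧
      ∀ t : ℕ, IsPAdicAvatarOf ι (ρ t) (r t) ∧ FactorsThroughZp κ₁ (r t) ∧ avatarValueAt (r t) γ₁⁻¹ = w * u ^ t ∧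
        (θK⁻¹ * ρ t).HasInfinityType (fun _ ↦ -((m₀ + N * t : ℕ) : ℤ)) (fun _ ↦ 0) ∧
        (∀ w' : HeightOneSpectrum (𝓞 K), w' ≠ v → (ρ t).IsUnramifiedAt w') ∧ (θK⁻¹ * ρ t).IsUnramifiedAt v ∧
        LFunction.HasEntireContinuation (heckeLFunction (θK⁻¹ * ρ t))) :
    PowerSeries.map (PowerSeries.constantCoeff (R := PadicComplexInt 2)) G₂ ≠ 0 ∧
    (θK.IsUnramifiedAt vbar →
      ∀ τ ∈ GreenbergSelmer.decomp vbar, κ₁ τ = κ₁ γ₁ → ∀ u : ℤ,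
        (∀ m : charModule (∅ : Set (PadicAlgCl 2)) θ, τ • m = u • m) →
        Ideal.span ({PowerSeries.map (PowerSeries.constantCoeff (R := PadicComplexInt 2)) G₂} : Set (PowerSeries (PadicComplexInt 2))) =
          Ideal.span {((1 : PowerSeries (PadicComplexInt 2)) + PowerSeries.X) - (u : PowerSeries (PadicComplexInt 2))} *
            Ideal.span {G₁}) ∧
    (¬ θK.IsUnramifiedAt vbar →
      Ideal.span ({PowerSeries.map (PowerSeries.constantCoeff (R := PadicComplexInt 2)) G₂} : Set (PowerSeries (PadicComplexInt 2))) =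
        Ideal.span {G₁}) := by
  have himag : ∀ w : InfinitePlace K, w.IsComplex := fun w ↦ hK.2.isComplex w
  -- §0 Hecke bookkeeping for the quadratic `θ`
  have hθKunr : ∀ w : HeightOneSpectrum (𝓞 K), θK.IsUnramifiedAt w → θ.IsUnramifiedAt w :=
    fun w hw ↦ LinePinThetaOne.isUnramifiedAt_of_isHeckeCharOf ι hθ2 hH hw
  obtain ⟨θK₀, hfin₀, hH₀, -⟩ := QuadraticPart.exists_heckeChar_of_pow_eq_one (∅ : Set (PadicAlgCl 2)) ι θ two_pos hθ2
  have hfin : θK.IsFiniteOrder := by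
    rw [LinePinThetaOne.heckeChar_eq_of_isHeckeCharOf ι hθ2 hH hH₀]; exact hfin₀
  have hθK0 : θK.HasInfinityType (fun _ ↦ (0 : ℤ)) (fun _ ↦ 0) := hasInfinityType_zero_of_isFiniteOrder hfin
  have hθKi0 : θK⁻¹.HasInfinityType (fun _ ↦ (0 : ℤ)) (fun _ ↦ 0) := by
    have h := hθK0.inv
    have e : (-fun _ : InfinitePlace K ↦ (0 : ℤ)) = fun _ ↦ 0 := by funext w; simp
    rwa [e] at h
  -- periods
  have hΩp : ((Ωp : unrIntegers 2) : ℂ_[2]) ≠ 0 := coe_unrIntegers_unit_ne_zero Ωp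
  have hΩp' : ((Ωp' : unrIntegers 2) : ℂ_[2]) ≠ 0 := coe_unrIntegers_unit_ne_zero Ωp'
  -- (i) `P = π_v G₂`: its values at the supply points are read DIRECTLY from the `j = 0` frame (`m ≥ 3`)
  -- the supply
  obtain ⟨ρ, r, w, u, m₀, N, hm₀, hN, hw, hu, hu1, hsup⟩ := hsupply
  have h2le : ‖(2 : ℂ_[2])‖ ≤ 1 := by
    have h := norm_prime_padicComplex_lt_one (p := 2)
    exact_mod_cast h.le
  have hu' : ‖u - 1‖ < 1 := hu.trans_le h2le
  have hroot : ∀ n : ℕ, 0 < n → u ^ n ≠ 1 :=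
    IntSeries.forall_pow_ne_one_of_norm_sub_one_lt hu1 (by exact_mod_cast hu)
  have hw1 : ‖w‖ ≤ 1 := (norm_eq_one_of_norm_sub_one_lt_one hw).le
  set w₀ : PadicComplexInt 2 := ⟨w, mem_padicComplexInt_iff.mpr hw1⟩ with hw₀def
  have hw₀ : ‖(w₀ : ℂ_[2]) - 1‖ < 1 := hw
  have hm : ∀ t : ℕ, 0 < m₀ + N * t := fun t ↦ by have := Nat.le_add_right m₀ (N * t); omega
  have hm3 : ∀ t : ℕ, 3 ≤ m₀ + N * t := fun t ↦ (hm₀.trans (Nat.le_add_right m₀ (N * t)))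
  have hγ₂inv : κ₁ γ₂⁻¹ = 1 := by rw [map_inv, hpair.apply_right, inv_one]
  have hnode : ∀ t : ℕ, avatarValueAt (r t) γ₁⁻¹ - 1 = (w₀ : ℂ_[2]) * u ^ t - 1 := fun t ↦ by
    rw [(hsup t).2.2.1]
  have hunrT : ∀ (t : ℕ) (w' : HeightOneSpectrum (𝓞 K)), w' ∉ insert vbar S → (θK⁻¹ * ρ t).IsUnramifiedAt w' := by
    intro t w' hw'
    rw [Finset.mem_insert, not_or] at hw'
    by_cases hw'v : w' = v
    · subst hw'v; exact (hsup t).2.2.2.2.2.1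
    · exact (hSunr w' hw'.2 hw'v hw'.1).inv'.mul' ((hsup t).2.2.2.2.1 w' hw'v)
  have hPval : ∀ t : ℕ, IntSeries.HasValueAt (PowerSeries.map (PowerSeries.constantCoeff (R := PadicComplexInt 2)) G₂)
      ((w₀ : ℂ_[2]) * u ^ t - 1)
      (((ι.symm (interpolationValue₀ 2 v (insert vbar S) (θK⁻¹ * ρ t) (m₀ + N * t) Ω
          ((hsup t).2.2.2.2.2.2.continuation 0)) : PadicAlgCl 2) : ℂ_[2]) * ((Ωp : unrIntegers 2) : ℂ_[2]) ^ (m₀ + N * t)) := by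
    intro t
    rw [← hnode t]
    exact KatzMeasureJZeroTransport.hasValueAt_map_constantCoeff₀ hG₂ hγ₂inv (hsup t).1 (hsup t).2.1 (hm3 t) (hsup t).2.2.2.1 (hunrT t)
      (hsup t).2.2.2.2.2.2
  -- (ii)/(iii) the two cases
  by_cases hunr : θK.IsUnramifiedAt vbar
  · -- UNRAMIFIED at `v̄`: `S' = S`, Euler factor at `v̄`
    have hS'eq : S' = S := by
      ext w'
      constructor
      · intro hw'
        by_contra h2
        have hw'v : w' ≠ v := fun h ↦ hvS' (h ▸ hw')
        by_cases h1 : w' = vbar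
        · exact hS'ram w' hw' (h1 ▸ hunr)
        · exact hS'ram w' hw' (hSunr w' h2 hw'v h1)
      · intro hw'
        by_contra h2
        exact hSram w' hw' (hS'unr w' h2 (fun h ↦ hvS (h ▸ hw')))
    rw [hS'eq] at hG₁
    have hθv : θ.IsUnramifiedAt vbar := hθKunr vbar hunr
    have hunrS : ∀ (t : ℕ) (w' : HeightOneSpectrum (𝓞 K)), w' ∉ S → (θK⁻¹ * ρ t).IsUnramifiedAt w' := by
      intro t w' hw'
      by_cases hw'v : w' = v
      · subst hw'v; exact (hsup t).2.2.2.2.2.1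
      by_cases hw'vb : w' = vbar
      · subst hw'vb; exact hunr.inv'.mul' ((hsup t).2.2.2.2.1 _ hne)
      · exact (hSunr w' hw' hw'v hw'vb).inv'.mul' ((hsup t).2.2.2.2.1 w' hw'v)
    -- the avatar dictionary at `v̄`
    obtain ⟨φ₀, hφ₀, hdict⟩ := exists_frob_dictionary (p := 2) ι himag hvbar hne hι
    have hc₀ : κ₁ (absGaloisRestrict K (vbar.adicCompletion K) φ₀) ≠ 1 :=
      apply_absGaloisRestrict_ne_one hK hv hvbar hne hκ₁ hφ₀
    -- `a = θ̃((res φ₀)⁻¹) = ι⁻¹ θ_K⁻¹(ϖ_v̄)`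
    have hθav : IsPAdicAvatarOf ι θK⁻¹
        (FramedRep.baseChange (padicCoeffIntegers (∅ : Set (PadicAlgCl 2))).subtype continuous_subtype_val θ) :=
      isPAdicAvatarOf_inv_of_isHeckeCharOf _ ι hH hθKunr
    have hθKT : ∀ w' : HeightOneSpectrum (𝓞 K), w' ∉ insert v (insert vbar S) → θK⁻¹.IsUnramifiedAt w' := by
      intro w' hw'
      simp only [Finset.mem_insert, not_or] at hw'
      exact (hSunr w' hw'.2.2 hw'.1 hw'.2.1).inv'
    have ha : avatarValueAt (FramedRep.baseChange (padicCoeffIntegers (∅ : Set (PadicAlgCl 2))).subtype continuous_subtype_val θ)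
        (absGaloisRestrict K (vbar.adicCompletion K) φ₀)⁻¹ = ((ι.symm (θK⁻¹.valueAtUniformizer vbar) : PadicAlgCl 2) : ℂ_[2]) :=
      hdict θK⁻¹ 0 _ _ hθKT hunr.inv' hθKi0 hθav
    set a : PadicComplexInt 2 := ⟨avatarValueAt (FramedRep.baseChange (padicCoeffIntegers (∅ : Set (PadicAlgCl 2))).subtype
      continuous_subtype_val θ) (absGaloisRestrict K (vbar.adicCompletion K) φ₀)⁻¹, avatarValueAt_mem_padicComplexInt _ _⟩ with ha_def
    -- the dictionary at the supply points
    have hρtype : ∀ t : ℕ, (ρ t).HasInfinityType (fun _ ↦ -((m₀ + N * t : ℕ) : ℤ)) (fun _ ↦ 0) := by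
      intro t
      have h := hθK0.mul' (hsup t).2.2.2.1
      rw [mul_inv_cancel_left] at h
      convert h using 2 <;> simp
    have hρval : ∀ t : ℕ, avatarValueAt (r t) (absGaloisRestrict K (vbar.adicCompletion K) φ₀)⁻¹ =
        ((ι.symm ((ρ t).valueAtUniformizer vbar) : PadicAlgCl 2) : ℂ_[2]) := fun t ↦
      hdict (ρ t) _ {v} (r t) (fun w' hw' ↦ (hsup t).2.2.2.2.1 w' (by simpa using hw'))
        ((hsup t).2.2.2.2.1 vbar hne) (hρtype t) (hsup t).1
    have hval : ∀ t : ℕ, ((ι.symm (heckeValueExtZero (θK⁻¹ * ρ t) vbar) : PadicAlgCl 2) : ℂ_[2]) =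
        (a : ℂ_[2]) * avatarValueAt (r t) (absGaloisRestrict K (vbar.adicCompletion K) φ₀)⁻¹ := by
      intro t
      rw [heckeValueExtZero_of_isUnramifiedAt (hunr.inv'.mul' ((hsup t).2.2.2.2.1 vbar hne)),
        HeckeCharacter.valueAtUniformizer_mul', map_mul, hρval t, ha_def, Subtype.coe_mk, ha]
      push_cast
      rfl
    -- the Euler factor and `Q`
    have hexp : -(Multiplicative.toAdd (κ₁ (absGaloisRestrict K (vbar.adicCompletion K) φ₀)⁻¹)) =
        Multiplicative.toAdd (κ₁ (absGaloisRestrict K (vbar.adicCompletion K) φ₀)) := by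
      rw [map_inv, toAdd_inv, neg_neg]
    have hQval : ∀ t : ℕ, IntSeries.HasValueAt
        ((1 - PowerSeries.C a * IntSeries.binomPow (Multiplicative.toAdd (κ₁ (absGaloisRestrict K (vbar.adicCompletion K) φ₀)))) * G₁)
        ((w₀ : ℂ_[2]) * u ^ t - 1)
        (((ι.symm (interpolationValue₀ 2 v (insert vbar S) (θK⁻¹ * ρ t) (m₀ + N * t) Ω'
            ((hsup t).2.2.2.2.2.2.continuation 0)) : PadicAlgCl 2) : ℂ_[2]) * ((Ωp' : unrIntegers 2) : ℂ_[2]) ^ (m₀ + N * t)) := by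
      intro t
      rw [← hnode t, ← hexp]
      exact hG₁.hasValueAt_insert_of_avatarAt_inv hpair.left hvbS _ a (hsup t).1 (hsup t).2.1 (hm t) (hsup t).2.2.2.1
        (hunrS t) (hval t) (hsup t).2.2.2.2.2.2
    have hE0 : (1 - PowerSeries.C a * IntSeries.binomPow (Multiplicative.toAdd (κ₁ (absGaloisRestrict K (vbar.adicCompletion K) φ₀)))) ≠ 0 := by
      intro hE
      have h0 := congrArg (PowerSeries.constantCoeff (R := PadicComplexInt 2)) hE
      rw [map_sub, map_one, map_mul, PowerSeries.constantCoeff_C, IntSeries.constantCoeff_binomPow, mul_one, map_zero,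
        sub_eq_zero] at h0
      have h1 := congrArg (PowerSeries.coeff (R := PadicComplexInt 2) 1) hE
      rw [map_sub, PowerSeries.coeff_one, if_neg one_ne_zero, PowerSeries.coeff_C_mul, IntSeries.coeff_binomPow,
        Ring.choose_one_right, map_zero, zero_sub, neg_eq_zero, ← h0, one_mul,
        map_eq_zero_iff _ padicIntToComplexInt_injective, toAdd_eq_zero] at h1
      exact hc₀ h1
    have hQ0 : (1 - PowerSeries.C a * IntSeries.binomPow (Multiplicative.toAdd (κ₁ (absGaloisRestrict K (vbar.adicCompletion K) φ₀)))) *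
        G₁ ≠ 0 := mul_ne_zero hE0 hG₁0
    have hspan := span_eq_span_of_interpolationValue₀_values (ε := fun t ↦ θK⁻¹ * ρ t) (m := fun t ↦ m₀ + N * t)
      (L := fun t ↦ (hsup t).2.2.2.2.2.2.continuation 0) hw₀ hu' hroot (fun _ ↦ rfl) hN hΩ hΩ' hΩp hΩp' hPval hQval hQ0
    have hP0 := ne_zero_of_interpolationValue₀_values (ε := fun t ↦ θK⁻¹ * ρ t) (m := fun t ↦ m₀ + N * t)
      (L := fun t ↦ (hsup t).2.2.2.2.2.2.continuation 0) hw₀ hu' hroot hΩ hΩ' hΩp hΩp' hPval hQval hQ0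
    refine ⟨hP0, fun _ τ hτ hκτ uu hum ↦ ?_, fun hram ↦ absurd hunr hram⟩
    -- (iv) the stub's `(τ, u)`
    have hκτ1 : κ₁ τ = Multiplicative.ofAdd 1 := hκτ.trans hpair.left
    have hu1' : uu = 1 ∨ uu = -1 := eq_one_or_eq_neg_one_of_forall_smul hθ2 hum
    have hunit : IsUnit (Multiplicative.toAdd (κ₁ (absGaloisRestrict K (vbar.adicCompletion K) φ₀))) :=
      isUnit_toAdd_apply_absGaloisRestrict (hκ₁.inertia_le hne) hφ₀ hτ hκτ1
    have hθτ : unitChar θ τ = unitChar θ (absGaloisRestrict K (vbar.adicCompletion K) φ₀) :=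
      unitChar_eq_unitChar_absGaloisRestrict (hκ₁.inertia_le hne) θ hθ2 hθv hφ₀ hτ hκτ1
    have hinv : (unitChar θ (absGaloisRestrict K (vbar.adicCompletion K) φ₀))⁻¹ =
        unitChar θ (absGaloisRestrict K (vbar.adicCompletion K) φ₀) := by
      rcases unitChar_eq_one_or_eq_neg_one hθ2 (absGaloisRestrict K (vbar.adicCompletion K) φ₀) with h | h <;> rw [h] <;> simp
    have haU : a = (uu : PadicComplexInt 2) := by
      apply Subtype.ext
      rw [ha_def, Subtype.coe_mk, avatarValueAt_baseChange_subtype_empty_inv, hinv, ← hθτ, ← intCast_eq_unitChar_of_forall_smul θ hum,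
        map_intCast]
    rw [hspan, ← Ideal.span_singleton_mul_span_singleton, haU,
      EulerFactorNorm.span_one_sub_C_mul_binomPow_eq_span_of_isUnit uu hu1' hunit]
  · -- RAMIFIED at `v̄`: `S' = insert v̄ S`, no Euler factor
    have hS'eq : S' = insert vbar S := by
      ext w'
      simp only [Finset.mem_insert]
      constructor
      · intro hw'
        by_cases h1 : w' = vbar
        · exact Or.inl h1
        · right
          by_contra h2
          exact hS'ram w' hw' (hSunr w' h2 (fun h ↦ hvS' (h ▸ hw')) h1)
      · rintro (rfl | hw')
        · by_contra h2
          exact hunr (hS'unr _ h2 hne)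
        · by_contra h2
          exact hSram w' hw' (hS'unr w' h2 (fun h ↦ hvS (h ▸ hw')))
    rw [hS'eq] at hG₁
    have hQval : ∀ t : ℕ, IntSeries.HasValueAt G₁ ((w₀ : ℂ_[2]) * u ^ t - 1)
        (((ι.symm (interpolationValue₀ 2 v (insert vbar S) (θK⁻¹ * ρ t) (m₀ + N * t) Ω'
            ((hsup t).2.2.2.2.2.2.continuation 0)) : PadicAlgCl 2) : ℂ_[2]) * ((Ωp' : unrIntegers 2) : ℂ_[2]) ^ (m₀ + N * t)) := by
      intro t
      rw [← hnode t]
      exact hG₁.hasValueAt (hsup t).1 (hsup t).2.1 (hm t) (hsup t).2.2.2.1 (hunrT t) (hsup t).2.2.2.2.2.2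
    have hspan := span_eq_span_of_interpolationValue₀_values (ε := fun t ↦ θK⁻¹ * ρ t) (m := fun t ↦ m₀ + N * t)
      (L := fun t ↦ (hsup t).2.2.2.2.2.2.continuation 0) hw₀ hu' hroot (fun _ ↦ rfl) hN hΩ hΩ' hΩp hΩp' hPval hQval hG₁0
    have hP0 := ne_zero_of_interpolationValue₀_values (ε := fun t ↦ θK⁻¹ * ρ t) (m := fun t ↦ m₀ + N * t)
      (L := fun t ↦ (hsup t).2.2.2.2.2.2.continuation 0) hw₀ hu' hroot hΩ hΩ' hΩp hΩp' hPval hQval hG₁0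
    exact ⟨hP0, fun h ↦ absurd h hunr, fun _ ↦ hspan⟩


/-- ★★ **STUB (A) `stub_vLineRestriction` FOR `j = 0` FRAMES** (ty2 g36's statement VERBATIM with `IsKatzMeasure₂₀` in place of
`IsKatzMeasure₂`): on a DA7 frame, for `θ` quadratic with Hecke avatar `θ_K`, a `j = 0` two-variable frame `G₂` of the `θ_K⁻¹`-branch and any
`ν`-branch `G₁` of modulus `S'` generating the characteristic ideals of the line's dual data: `π_v G₂ ≠ 0`; `(π_v G₂) = ((1+T) − u)·(G₁)` if `θ_K` is
unramified at `v̄`; `(π_v G₂) = (G₁)` if `θ_K` is ramified at `v̄`.  Proof: cf2c-w3 g6's supply `VLineSupply.exists_vLineSupply_of_discr` SHIFTED by two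
nodes (`t ↦ t+2`, `w ↦ w·u²`, `m₀ ↦ m₀ + 2N ≥ 3`) fed to `vLineRestriction_of_supply₀`.
[cite: deShalit1987, II Thm. 4.12 (i)–(ii) (31)–(32), II.4.16 (49)–(50), II.4.17 (52)–(54)] [cite: Muller2020SplitPrimeTwo, Thm. 2.4, Def. 2.5] -/
theorem stub_vLineRestriction₀ :
    ∀ (K : Type) [Field K] [NumberField K], IsImaginaryQuadratic K → ¬ 2 ∣ NumberField.classNumber K →
      NumberField.discr K = -7 →
    ∀ (ι : PadicAlgCl 2 ≃+* ℂ) (v vbar : HeightOneSpectrum (𝓞 K)),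
      ((2 : ℕ) : 𝓞 K) ∈ v.asIdeal → ((2 : ℕ) : 𝓞 K) ∈ vbar.asIdeal → vbar ≠ v →
      (∀ (w : InfinitePlace K) (k : 𝓞 K), k ∈ v.asIdeal ↔ ‖ι.symm (w.embedding (k : K))‖ < 1) →
    ∀ (Ω δ : ℂ) (Ωp : (unrIntegers 2)ˣ), Ω ≠ 0 →
      (δ ^ 2 = (NumberField.discr K : ℂ) ∨ δ ^ 2 = -(NumberField.discr K : ℂ)) →
    ∀ (κ₁ κ₂ : ZpExtension K 2) (γ₁ γ₂ : absoluteGaloisGroup K),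
      ZpExtension.IsTopGeneratorPair κ₁ κ₂ γ₁ γ₂ → κ₂.IsUnramifiedOutside vbar →
      κ₁.IsUnramifiedOutside v → γ₁ ∈ GreenbergSelmer.inertia v → γ₂ ∈ GreenbergSelmer.inertia vbar →
    ∀ (θ : FramedGaloisRep K (padicCoeffIntegers (∅ : Set (PadicAlgCl 2))) 1),
      (∀ σ : absoluteGaloisGroup K, θ σ ^ 2 = 1) → (∃ σ ∈ κ₁.kerSubgroup, θ σ ≠ 1) →
    ∀ (θK : HeckeCharacter K), KellerYin2024.IsHeckeCharOf ι θ θK →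
    ∀ (S : Finset (HeightOneSpectrum (𝓞 K))), v ∉ S → vbar ∉ S →
      (∀ w ∈ S, ¬ θK.IsUnramifiedAt w) →
      (∀ w : HeightOneSpectrum (𝓞 K), w ∉ S → w ≠ v → w ≠ vbar → θK.IsUnramifiedAt w) →
    ∀ G₂ : PowerSeries (PowerSeries (PadicComplexInt 2)),
      IsKatzMeasure₂₀ ι v vbar S κ₁ κ₂ γ₁⁻¹ γ₂⁻¹ θK⁻¹ Ω δ ((Ωp : unrIntegers 2) : ℂ_[2]) G₂ →
    -- Müller's branch on the `v`-line: modulus `S'` = exact ramification set of `θ_K` away from `v`, ANY admissible periods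
    ∀ (S' : Finset (HeightOneSpectrum (𝓞 K))), v ∉ S' → (∀ w ∈ S', ¬ θK.IsUnramifiedAt w) →
      (∀ w : HeightOneSpectrum (𝓞 K), w ∉ S' → w ≠ v → θK.IsUnramifiedAt w) →
    ∀ (Ω' : ℂ) (Ωp' : (unrIntegers 2)ˣ) (G₁ : PowerSeries (PadicComplexInt 2)), Ω' ≠ 0 →
      IsNuBranch ι v S' κ₁ γ₁⁻¹ θK⁻¹ Ω' ((Ωp' : unrIntegers 2) : ℂ_[2]) G₁ →
      (∀ D₁ : DatumDualData κ₁ γ₁ (KellerYin2024.charModule (∅ : Set (PadicAlgCl 2)) θ)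
          (Castella2018.AcSelmer.bdpData (KellerYin2024.charModule (∅ : Set (PadicAlgCl 2)) θ) 2 vbar) ∅,
        Module.Finite (IwasawaAlgebra 2) D₁.X ∧ Module.IsTorsion (IwasawaAlgebra 2) D₁.X ∧
        ∀ (J : ℤ_[2] →+* PadicComplexInt 2),
          (∀ x : ℤ_[2], ((J x : PadicComplexInt 2) : ℂ_[2]) = ((x : ℚ_[2]) : ℂ_[2])) →
          (Module.charIdeal (IwasawaAlgebra 2) D₁.X).map (PowerSeries.map J) = Ideal.span {G₁}) →
    PowerSeries.map (PowerSeries.constantCoeff (R := PadicComplexInt 2)) G₂ ≠ 0 ∧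
    (θK.IsUnramifiedAt vbar →
      ∀ τ ∈ GreenbergSelmer.decomp vbar, κ₁ τ = κ₁ γ₁ → ∀ u : ℤ,
        (∀ m : KellerYin2024.charModule (∅ : Set (PadicAlgCl 2)) θ, τ • m = u • m) →
        Ideal.span ({PowerSeries.map (PowerSeries.constantCoeff (R := PadicComplexInt 2)) G₂} : Set (PowerSeries (PadicComplexInt 2))) =
          Ideal.span {((1 : PowerSeries (PadicComplexInt 2)) + PowerSeries.X) - (u : PowerSeries (PadicComplexInt 2))} *
            Ideal.span {G₁}) ∧
    (¬ θK.IsUnramifiedAt vbar →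
      Ideal.span ({PowerSeries.map (PowerSeries.constantCoeff (R := PadicComplexInt 2)) G₂} : Set (PowerSeries (PadicComplexInt 2))) =
        Ideal.span {G₁}) := by
  intro K _ _ hK _hodd hdisc ι v vbar hv hvbar hne hι Ω δ Ωp hΩ _hδ κ₁ κ₂ γ₁ γ₂ hpair _hκ₂ hκ₁ _hγ₁ _hγ₂ θ hθ2 _hθne θK hH S hvS hvbS hSram hSunr
    G₂ hG₂ S' hvS' hS'ram hS'unr Ω' Ωp' G₁ hΩ' hG₁ hM
  -- cf2c-w3 g6's supply, SHIFTED BY TWO NODES so that every weight is `≥ 3`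
  obtain ⟨ρ, r, w, u, m₀, N, hm₀, hN, hw, hu, hu1, -, hsup⟩ := VLineSupply.exists_vLineSupply_of_discr hK hdisc hv hvbar hne ι hι hpair hκ₁ hθ2 hH
  have h2le : ‖(2 : ℂ_[2])‖ ≤ 1 := by
    have h := norm_prime_padicComplex_lt_one (p := 2)
    exact_mod_cast h.le
  have hu' : ‖u - 1‖ < 1 := hu.trans_le h2le
  have hw' : ‖w * u ^ 2 - 1‖ < 1 := by
    have hu2 : ‖u ^ 2 - 1‖ < 1 := by
      have e : u ^ 2 - 1 = (u - 1) * (u + 1) := by ring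
      have h1 : ‖u + 1‖ ≤ 1 := by
        have e2 : u + 1 = (u - 1) + 2 := by ring
        rw [e2]
        exact (IsUltrametricDist.norm_add_le_max _ _).trans (max_le hu'.le h2le)
      rw [e, norm_mul]
      calc ‖u - 1‖ * ‖u + 1‖ ≤ ‖u - 1‖ * 1 := by gcongr
        _ < 1 := by rw [mul_one]; exact hu'
    have e : w * u ^ 2 - 1 = (w - 1) * u ^ 2 + (u ^ 2 - 1) := by ring
    have hun : ‖u ^ 2‖ ≤ 1 := by
      rw [norm_pow]; exact pow_le_one₀ (norm_nonneg _) ((norm_eq_one_of_norm_sub_one_lt_one hu').le)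
    rw [e]
    refine (IsUltrametricDist.norm_add_le_max _ _).trans_lt (max_lt ?_ hu2)
    calc ‖(w - 1) * u ^ 2‖ = ‖w - 1‖ * ‖u ^ 2‖ := norm_mul _ _
      _ ≤ ‖w - 1‖ * 1 := by gcongr
      _ < 1 := by rw [mul_one]; exact hw
  have hmt : ∀ t : ℕ, m₀ + N * 2 + N * t = m₀ + N * (t + 2) := fun t ↦ by ring
  refine vLineRestriction_of_supply₀ hK ι hv hvbar hne hι hΩ hpair hκ₁ hθ2 hH hvS hvbS hSram hSunr hG₂ hvS' hS'ram hS'unr hΩ' hG₁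
    (ne_zero_of_charIdeal_map_eq_span hpair.left θ vbar hM)
    ⟨fun t ↦ ρ (t + 2), fun t ↦ r (t + 2), w * u ^ 2, u, m₀ + N * 2, N, ?_, hN, hw', hu, hu1, fun t ↦ ⟨(hsup (t + 2)).1, (hsup (t + 2)).2.1, ?_, ?_,
      (hsup (t + 2)).2.2.2.2.2.2.2.1, (hsup (t + 2)).2.2.2.2.2.2.2.2.1, (hsup (t + 2)).2.2.2.2.2.2.2.2.2.2⟩⟩
  · have : 1 ≤ N := hN
    nlinarith
  · rw [(hsup (t + 2)).2.2.2.1]; ring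
  · rw [hmt]; exact (hsup (t + 2)).2.2.2.2.2.2.1


end Summit.BirchSwinnertonDyer.BirchSwinnertonDyer.Theorems.PrintCf2.VLineRestrictionJZero

end
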